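import Summits.HubbardSuperconductivity.HubbardSuperconductivity.Theorems.TwTipContinuation.Negative.TipNormalForm
import Literature.MathematicalPhysics.QuantumLattice.PatchPairOperator
import Literature.MathematicalPhysics.QuantumLattice.TorusCooperSum

/-!
# `TwTipContinuation` (stmt-HubbardSuperconductivity-1700), line `isogap-submodular-transport`,
# stub `stub_edgeOrder` — piece 2: the free-fermion sector energy in chemical-potential form

For the free torus `T = hubbardTorus 2 L 1 0 = Σ_{kσ} ε_L(k) n_{kσ}` (`L ≥ 3`,
`hubbardTorusWith_zero_eq_sum_momentumNumber`) and ANY real `μ`, every normalised `N`-particle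
vector has `re⟨ψ, T ψ⟩ ≥ Σ_k 2 min(ε_L(k) − μ, 0) + μ N`, because `0 ≤ ⟨n_{kσ}⟩ ≤ 1` (CAR) and
`Σ_{kσ} ⟨n_{kσ}⟩ = N`. Consequences on the literal route terms: the free sector energy
`E_L(0,0)` in the sector `(2n, S^z = 0)` is at least `Σ_k 2 min(ε_L(k) − μ, 0) + 2μn`
(`freeSectorEnergy_ge`), the seeded sector energy `E_L(0,c)` is at least the same minus
`c · C_d · L²` (`seededSectorEnergy_ge`, `re⟨P_L⟩ ≤ C_d L⁴`), and both are at most `8 L²`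
(`seededSectorEnergy_le`). No sorting of levels is needed (the chemical-potential form is all the
BCS trial-state comparison consumes).
-/

noncomputable section

namespace Summit.HubbardSuperconductivity.TwTipContinuation.IsogapTransport

open Matrix Filter Finset
open Literature.MathematicalPhysics.QuantumLattice Literature.Probability.LatticeModels
open Summit.HubbardSuperconductivity.TwTipContinuation.Negative
open scoped ComplexOrder

variable {L : ℕ} [NeZero L]

/-- `1 − n_{kσ} = c_{kσ} c†_{kσ}` (mixed CAR at coincident labels). [folklore] -/
theorem one_sub_momentumNumber (k : TorusSite 2 L) (σ : Fin 2) :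
    (1 : Matrix (Finset (Orb (FermionTorus 2 L))) (Finset (Orb (FermionTorus 2 L))) ℂ) - momentumNumber k σ =
      momentumAnnihilation k σ * momentumCreation k σ := by
  rw [momentumAnnihilation_mul_momentumCreation, if_pos ⟨rfl, rfl⟩, momentumNumber]

/-- `0 ≤ re⟨ψ, n_{kσ} ψ⟩`. [folklore] -/
theorem re_expect_momentumNumber_nonneg (k : TorusSite 2 L) (σ : Fin 2)
    (ψ : Fock (Orb (FermionTorus 2 L))) : 0 ≤ (expect (momentumNumber k σ) ψ).re :=
  (Complex.nonneg_iff.1 ((posSemidef_momentumNumber k σ).dotProduct_mulVec_nonneg ψ)).1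

/-- `re⟨ψ, n_{kσ} ψ⟩ ≤ re⟨ψ, ψ⟩` (`1 − n_{kσ} = (c†_{kσ})ᴴ c†_{kσ} ≥ 0`). [folklore] -/
theorem re_expect_momentumNumber_le (k : TorusSite 2 L) (σ : Fin 2)
    (ψ : Fock (Orb (FermionTorus 2 L))) :
    (expect (momentumNumber k σ) ψ).re ≤ (star ψ ⬝ᵥ ψ).re := by
  have hpsd : ((1 : Matrix (Finset (Orb (FermionTorus 2 L))) (Finset (Orb (FermionTorus 2 L))) ℂ) -
      momentumNumber k σ).PosSemidef := by
    rw [one_sub_momentumNumber, ← momentumCreation_conjTranspose]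
    exact posSemidef_conjTranspose_mul_self _
  have h := (Complex.nonneg_iff.1 (hpsd.dotProduct_mulVec_nonneg ψ)).1
  rw [sub_mulVec, one_mulVec, dotProduct_sub, Complex.sub_re] at h
  have : (expect (momentumNumber k σ) ψ).re = (star ψ ⬝ᵥ momentumNumber k σ *ᵥ ψ).re := rfl
  linarith

/-- `(ε − μ) x ≥ min(ε − μ, 0)` for an occupation `x ∈ [0,1]`. [folklore] -/
theorem mul_occupation_ge_min {a x : ℝ} (hx0 : 0 ≤ x) (hx1 : x ≤ 1) : min a 0 ≤ a * x := by
  rcases le_total 0 a with ha | ha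
  · exact (min_le_right _ _).trans (mul_nonneg ha hx0)
  · calc min a 0 ≤ a := min_le_left _ _
      _ = a * 1 := (mul_one a).symm
      _ ≤ a * x := mul_le_mul_of_nonpos_left hx1 ha

omit [NeZero L] in
/-- `(ε − μ) x ≤ 4` for a square-lattice band energy `ε ∈ [−4,4]`, `|μ| ≤ …` not needed:
`ε x ≤ 4` for `x ∈ [0,1]`. [folklore] -/
theorem torusBand_mul_occupation_le (k : TorusSite 2 L) {x : ℝ} (hx0 : 0 ≤ x) (hx1 : x ≤ 1) :
    torusBand L k * x ≤ 4 := by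
  have h1 := torusBand_le_four L k
  have h2 := neg_four_le_torusBand L k
  nlinarith

/-- **The free kinetic energy in chemical-potential form.** For `L ≥ 3`, any real `μ` and any
normalised `N`-particle vector `ψ` of the fermionic torus,
`Σ_k 2 min(ε_L(k) − μ, 0) + μ N ≤ re⟨ψ, hubbardTorus 2 L 1 0 ψ⟩`. [folklore] -/
theorem re_expect_hubbardTorus_zero_ge (hL : 3 ≤ L) (μ : ℝ) {N : ℕ}
    {ψ : Fock (Orb (FermionTorus 2 L))} (hψN : IsNParticle N ψ) (hψ1 : star ψ ⬝ᵥ ψ = 1) :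
    ∑ k : TorusSite 2 L, 2 * min (torusBand L k - μ) 0 + μ * N ≤
      (expect (hubbardTorus 2 L 1 0) ψ).re := by
  have hdec : hubbardTorus 2 L 1 0 = hubbardTorusWith 2 L 1 0 μ + (μ : ℂ) • totalNumber := by
    rw [hubbardTorusWith_eq, sub_add_cancel]
  have hN : expect totalNumber ψ = (N : ℂ) := by
    rw [hψN.expect_totalNumber, hψ1, mul_one]
  rw [hdec, expect_add, expect_smul, hN, hubbardTorusWith_zero_eq_sum_momentumNumber hL μ,
    expect_sum, Complex.add_re, Complex.re_sum]
  have hμN : ((μ : ℂ) * (N : ℂ)).re = μ * N := by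
    rw [← Complex.ofReal_natCast, ← Complex.ofReal_mul, Complex.ofReal_re]
  rw [hμN]
  gcongr with k
  rw [expect_sum, Complex.re_sum, Fin.sum_univ_two, expect_smul, expect_smul, Complex.re_ofReal_mul,
    Complex.re_ofReal_mul, two_mul]
  have h0 := fun σ => re_expect_momentumNumber_nonneg k σ ψ
  have h1 : ∀ σ, (expect (momentumNumber k σ) ψ).re ≤ 1 := fun σ => by
    have := re_expect_momentumNumber_le k σ ψ
    rwa [hψ1, Complex.one_re] at this
  exact add_le_add (mul_occupation_ge_min (h0 0) (h1 0)) (mul_occupation_ge_min (h0 1) (h1 1))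

/-- **The free kinetic energy is at most `8L²`** on normalised vectors (`ε_L(k) ≤ 4`,
`⟨n_{kσ}⟩ ≤ 1`, `2L²` modes). [folklore] -/
theorem re_expect_hubbardTorus_zero_le (hL : 3 ≤ L)
    {ψ : Fock (Orb (FermionTorus 2 L))} (hψ1 : star ψ ⬝ᵥ ψ = 1) :
    (expect (hubbardTorus 2 L 1 0) ψ).re ≤ 8 * (L : ℝ) ^ 2 := by
  rw [hubbardTorus_zero_eq_sum_momentumNumber hL, expect_sum, Complex.re_sum]
  have h0 := fun k σ => re_expect_momentumNumber_nonneg k σ ψ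
  have h1 : ∀ (k : TorusSite 2 L) σ, (expect (momentumNumber k σ) ψ).re ≤ 1 := fun k σ => by
    have := re_expect_momentumNumber_le k σ ψ
    rwa [hψ1, Complex.one_re] at this
  calc ∑ k : TorusSite 2 L, (expect (∑ σ : Fin 2, ((torusBand L k : ℝ) : ℂ) • momentumNumber k σ) ψ).re
      ≤ ∑ _k : TorusSite 2 L, (8 : ℝ) := by
        refine Finset.sum_le_sum fun k _ => ?_
        rw [expect_sum, Complex.re_sum, Fin.sum_univ_two, expect_smul, expect_smul,
          Complex.re_ofReal_mul, Complex.re_ofReal_mul]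
        have := torusBand_mul_occupation_le k (h0 k 0) (h1 k 0)
        have := torusBand_mul_occupation_le k (h0 k 1) (h1 k 1)
        linarith
    _ = 8 * (L : ℝ) ^ 2 := by
        rw [Finset.sum_const, Finset.card_univ, card_torusSite_two, nsmul_eq_mul]
        push_cast
        ring

/-- **Free sector energy, chemical-potential form (piece 2 of `stub_edgeOrder`).** For `L ≥ 3`,
any real `μ` and `n ≤ L²`, the free sector energy of the pure `U = 0` torus in the sector
`(2n, S^z = 0)` satisfies `Σ_k 2 min(ε_L(k) − μ, 0) + 2μn ≤ E_L(0,0)`. [folklore] -/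
theorem freeSectorEnergy_ge :
    ∀ (L : ℕ) [NeZero L], 3 ≤ L → ∀ (μ : ℝ) (n : ℕ), n ≤ Fintype.card (FermionTorus 2 L) → ∑ k : TorusSite 2 L, 2 * min (torusBand L k - μ) 0 + μ * (2 * n) ≤ Matrix.minEnergyOn (hubbardTorus 2 L 1 0) (szSector (2 * n) 0) := by
  intro L _ hL μ n hn
  obtain ⟨ψ, hψ1, hgs⟩ := exists_unit_groundState 0 0 L hn
  rw [seededH_zero] at hgs
  have hE := expect_eq_of_groundState L hψ1 hgs
  have hψN : IsNParticle (2 * n) ψ := ((mem_szSector_iff _ _ _).1 hgs.1).1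
  have h := re_expect_hubbardTorus_zero_ge hL μ hψN hψ1
  rw [hE, Complex.ofReal_re] at h
  exact_mod_cast h

/-- **Seeded sector energy from below.** For `L ≥ 3`, `c ≥ 0`, any real `μ` and `n ≤ L²`:
`Σ_k 2 min(ε_L(k) − μ, 0) + 2μn − c·C_d·L² ≤ E_L(0,c)`, `C_d` the constant of
`expect_pairIntensity_le` (`re⟨P_L⟩ ≤ C_d L⁴` on unit vectors). [folklore] -/
theorem seededSectorEnergy_ge (hL : 3 ≤ L) (μ : ℝ) {c : ℝ} (hc : 0 ≤ c) {n : ℕ}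
    (hn : n ≤ Fintype.card (FermionTorus 2 L)) :
    ∑ k : TorusSite 2 L, 2 * min (torusBand L k - μ) 0 + μ * (2 * n) -
        c * (∑ e ∈ insert 0 unitSteps, ‖((dWaveFormFactor e / Real.sqrt 2 : ℝ) : ℂ)‖ * 2) ^ 2 * (L : ℝ) ^ 2 ≤
      Matrix.minEnergyOn (hubbardTorus 2 L 1 0 - ((c / (L : ℝ) ^ 2 : ℝ) : ℂ) • ((pairField dWaveFormFactor L)ᴴ * pairField dWaveFormFactor L)) (szSector (2 * n) 0) := by
  obtain ⟨ψ, hψ1, hgs⟩ := exists_unit_groundState 0 c L hn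
  have hE := expect_eq_of_groundState L hψ1 hgs
  have hψN : IsNParticle (2 * n) ψ := ((mem_szSector_iff _ _ _).1 hgs.1).1
  have hT := re_expect_hubbardTorus_zero_ge hL μ hψN hψ1
  have hP := expect_pairIntensity_le L ψ hψ1
  have hsplit := expect_seededH_re 0 0 L c ψ
  rw [seededH_zero, sub_zero] at hsplit
  have hEr : (expect (hubbardTorus 2 L 1 0 - ((c / (L : ℝ) ^ 2 : ℝ) : ℂ) • ((pairField dWaveFormFactor L)ᴴ * pairField dWaveFormFactor L)) ψ).re =
      Matrix.minEnergyOn (hubbardTorus 2 L 1 0 - ((c / (L : ℝ) ^ 2 : ℝ) : ℂ) • ((pairField dWaveFormFactor L)ᴴ * pairField dWaveFormFactor L)) (szSector (2 * n) 0) := by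
    rw [hE, Complex.ofReal_re]
  have hLpos : (0 : ℝ) < (L : ℝ) ^ 2 := by
    have := NeZero.pos L
    positivity
  have hkey : c / (L : ℝ) ^ 2 * (expect ((pairField dWaveFormFactor L)ᴴ * pairField dWaveFormFactor L) ψ).re ≤
      c * (∑ e ∈ insert 0 unitSteps, ‖((dWaveFormFactor e / Real.sqrt 2 : ℝ) : ℂ)‖ * 2) ^ 2 * (L : ℝ) ^ 2 := by
    calc c / (L : ℝ) ^ 2 * (expect ((pairField dWaveFormFactor L)ᴴ * pairField dWaveFormFactor L) ψ).re
        ≤ c / (L : ℝ) ^ 2 * ((∑ e ∈ insert 0 unitSteps, ‖((dWaveFormFactor e / Real.sqrt 2 : ℝ) : ℂ)‖ * 2) ^ 2 * (L : ℝ) ^ 4) :=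
          mul_le_mul_of_nonneg_left hP (div_nonneg hc hLpos.le)
      _ = _ := by
          set Cd := (∑ e ∈ insert 0 unitSteps, ‖((dWaveFormFactor e / Real.sqrt 2 : ℝ) : ℂ)‖ * 2) ^ 2
          field_simp
  have hcast : (μ * ((2 * n : ℕ) : ℝ) : ℝ) = μ * (2 * n) := by push_cast; ring
  linarith

/-- **Seeded sector energy from above**: `E_L(0,c) ≤ 8L²` (`c ≥ 0`, `L ≥ 3`, `n ≤ L²`): evaluate
at a normalised sector ground state, drop `−(c/L²)re⟨P_L⟩ ≤ 0`. [folklore] -/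
theorem seededSectorEnergy_le (hL : 3 ≤ L) {c : ℝ} (hc : 0 ≤ c) {n : ℕ}
    (hn : n ≤ Fintype.card (FermionTorus 2 L)) :
    Matrix.minEnergyOn (hubbardTorus 2 L 1 0 - ((c / (L : ℝ) ^ 2 : ℝ) : ℂ) • ((pairField dWaveFormFactor L)ᴴ * pairField dWaveFormFactor L)) (szSector (2 * n) 0) ≤
      8 * (L : ℝ) ^ 2 := by
  obtain ⟨ψ, hψ1, hgs⟩ := exists_unit_groundState 0 c L hn
  have hE := expect_eq_of_groundState L hψ1 hgs
  have hT := re_expect_hubbardTorus_zero_le hL hψ1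
  have hP := expect_pairIntensity_nonneg L ψ
  have hsplit := expect_seededH_re 0 0 L c ψ
  rw [seededH_zero, sub_zero] at hsplit
  have hEr : (expect (hubbardTorus 2 L 1 0 - ((c / (L : ℝ) ^ 2 : ℝ) : ℂ) • ((pairField dWaveFormFactor L)ᴴ * pairField dWaveFormFactor L)) ψ).re =
      Matrix.minEnergyOn (hubbardTorus 2 L 1 0 - ((c / (L : ℝ) ^ 2 : ℝ) : ℂ) • ((pairField dWaveFormFactor L)ᴴ * pairField dWaveFormFactor L)) (szSector (2 * n) 0) := by
    rw [hE, Complex.ofReal_re]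
  have hLpos : (0 : ℝ) < (L : ℝ) ^ 2 := by
    have := NeZero.pos L
    positivity
  have : 0 ≤ c / (L : ℝ) ^ 2 * (expect ((pairField dWaveFormFactor L)ᴴ * pairField dWaveFormFactor L) ψ).re :=
    mul_nonneg (div_nonneg hc hLpos.le) hP
  linarith

end Summit.HubbardSuperconductivity.TwTipContinuation.IsogapTransport
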